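import Mathlib
import Summits.Ventures.PercRepro2.Defs
import Summits.Ventures.PercRepro2.Graph
import Summits.Ventures.PercRepro2.OneColourSwitch
import Summits.Ventures.PercRepro2.RegionHubSign
import Summits.Ventures.PercRepro2.SideSwitch
import Summits.Ventures.PercRepro2.M9NoPocketDefs
import Summits.Ventures.PercRepro2.M9GeneralDHD

/-!
# Edges inside `{r, s}` do not change the worlds (blind cell PercRepro2, p3 g39, 2026-08-29;
`proofs/P3-POCKETRK.md` §10″: removing the hypothesis «no edge inside `{r, s}`»)

For a predicate `P` on the edges, the RESTRICTION of `ends` and of a colouring `ω` to the edges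
satisfying `P` is `fun e : {e // P e} => ends e.1` and `fun e => ω e.1`.  A restricted `Y`-path
is a `Y`-path (`conn_of_conn_restrict`), and a full `Y`-path from `x` is a restricted one when
no removed open edge leaves the restricted cluster of `x` (`conn_restrict_of_conn`).  For the
removed edges INSIDE `{r, s}` (loops at `r`, `s` and `r`–`s` edges) this gives: the worlds
`K₂`, `M₂` of `{r, s}` are unchanged (`K2_restrict_eq`, `M2_restrict_eq`), hence `Sep` and
`DOne` (`sep2_restrict_iff`, `DOne_restrict_iff`); the `W`-cluster of a `d ∉ M₂` is unchanged
(`conn_compl_d_restrict_iff`), hence the `W`-defect; `σ_pq` is unchanged at a `Sep` point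
(`sigma_pq_restrict_eq`); and `r ~_Y s` holds iff it holds in the restriction or an open
`r`–`s` edge was removed (`conn_rs_restrict_iff`).  Own work; std axioms.
-/

namespace Summit.Ventures.PercRepro2

namespace NoPocket

open Finset Classical OneColourSwitch SideSwitch

variable {V : Type*} {E : Type*} {ends : E → Sym2 V} {p q r s d : V} {ω : Config E}

section General

variable {P : E → Prop}

/-- The restricted open graph is a subgraph of the open graph. -/
lemma openGraph_restrict_le :
    openGraph (fun e : {e // P e} => ends e.1) (fun e => ω e.1) ≤ openGraph ends ω := by
  intro u v huv
  rw [openGraph_adj] at huv ⊢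
  obtain ⟨hne, e, he, hends⟩ := huv
  exact ⟨hne, e.1, he, hends⟩

/-- A restricted `Y`-path is a `Y`-path. -/
lemma conn_of_conn_restrict {x y : V}
    (h : Conn (fun e : {e // P e} => ends e.1) (fun e => ω e.1) x y) : Conn ends ω x y :=
  SimpleGraph.Reachable.mono openGraph_restrict_le h

/-- A `Y`-path from `x` is a restricted `Y`-path when no removed open edge leaves the
restricted cluster of `x`. -/
lemma conn_restrict_of_conn {x y : V}
    (hS : ∀ e, ¬ P e → ω e = true → ∀ a b, ends e = s(a, b) →
      Conn (fun e : {e // P e} => ends e.1) (fun e => ω e.1) x a →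
      Conn (fun e : {e // P e} => ends e.1) (fun e => ω e.1) x b)
    (h : Conn ends ω x y) : Conn (fun e : {e // P e} => ends e.1) (fun e => ω e.1) x y := by
  refine mem_of_conn_of_closed
    (S := cluster (fun e : {e // P e} => ends e.1) (fun e => ω e.1) x) ?_
    (mem_cluster_self _ _ _) h
  intro a ha b hab
  rw [mem_cluster] at ha ⊢
  obtain ⟨_, e, he, hends⟩ := openGraph_adj.1 hab
  by_cases hP : P e
  · exact conn_trans ha (conn_of_openAdj ⟨⟨e, hP⟩, he, hends⟩)
  · exact hS e hP he a b hends ha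

end General

section Marks

/-- An edge inside `{r, s}` has both endpoints in `{r, s}`. -/
lemma endpoint_of_mem_within {e : E} (he : e ∈ within ends ({r, s} : Set V)) {a b : V}
    (hab : ends e = s(a, b)) : (a = r ∨ a = s) ∧ (b = r ∨ b = s) := by
  obtain ⟨u, hu, v, hv, huv⟩ := he
  simp only [Set.mem_insert_iff, Set.mem_singleton_iff] at hu hv
  rw [hab, Sym2.eq_iff] at huv
  rcases huv with ⟨h1, h2⟩ | ⟨h1, h2⟩
  · rw [h1, h2]; exact ⟨hu, hv⟩
  · rw [h1, h2]; exact ⟨hv, hu⟩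

/-- **The `Y`-world of `{r, s}` does not see the edges inside `{r, s}`.** -/
lemma K2_restrict_eq (r s : V) (ω : Config E) :
    K2 ends r s ω =
      K2 (fun e : {e // e ∉ within ends ({r, s} : Set V)} => ends e.1) r s (fun e => ω e.1) := by
  ext x
  rw [mem_K2_iff, mem_K2_iff]
  constructor
  · intro h
    have key : ∀ t, (t = r ∨ t = s) → Conn ends ω t x →
        Conn (fun e : {e // e ∉ within ends ({r, s} : Set V)} => ends e.1) (fun e => ω e.1) r x ∨
        Conn (fun e : {e // e ∉ within ends ({r, s} : Set V)} => ends e.1) (fun e => ω e.1) s x := by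
      intro t ht hc
      refine mem_of_conn_of_closed (S := {y | Conn (fun e : {e // e ∉ within ends ({r, s} : Set V)} =>
        ends e.1) (fun e => ω e.1) r y ∨ Conn (fun e : {e // e ∉ within ends ({r, s} : Set V)} =>
        ends e.1) (fun e => ω e.1) s y}) ?_ ?_ hc
      · intro a ha b hab
        obtain ⟨_, e, he, hends⟩ := openGraph_adj.1 hab
        by_cases hP : e ∈ within ends ({r, s} : Set V)
        · rcases (endpoint_of_mem_within hP hends).2 with rfl | rfl
          · exact Or.inl (conn_refl _ _ _)
          · exact Or.inr (conn_refl _ _ _)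
        · rcases ha with ha | ha
          · exact Or.inl (conn_trans ha (conn_of_openAdj ⟨⟨e, hP⟩, he, hends⟩))
          · exact Or.inr (conn_trans ha (conn_of_openAdj ⟨⟨e, hP⟩, he, hends⟩))
      · rcases ht with rfl | rfl
        · exact Or.inl (conn_refl _ _ _)
        · exact Or.inr (conn_refl _ _ _)
    rcases h with h | h
    · exact key r (Or.inl rfl) h
    · exact key s (Or.inr rfl) h
  · rintro (h | h)
    · exact Or.inl (conn_of_conn_restrict h)
    · exact Or.inr (conn_of_conn_restrict h)

/-- **The `W`-world of `{r, s}` does not see the edges inside `{r, s}`.** -/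
lemma M2_restrict_eq (r s : V) (ω : Config E) :
    M2 ends r s ω =
      M2 (fun e : {e // e ∉ within ends ({r, s} : Set V)} => ends e.1) r s (fun e => ω e.1) :=
  K2_restrict_eq r s (OneColourSwitch.compl ω)

/-- A mark `u` is not `Y`-joined to `t ∈ {r, s}` when it is not in the restriction. -/
lemma not_conn_mark_restrict {u t : V} (ht : t = r ∨ t = s)
    (h1 : ¬ Conn (fun e : {e // e ∉ within ends ({r, s} : Set V)} => ends e.1) (fun e => ω e.1) u r)
    (h2 : ¬ Conn (fun e : {e // e ∉ within ends ({r, s} : Set V)} => ends e.1) (fun e => ω e.1) u s) :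
    ¬ Conn ends ω u t := by
  intro hc
  have hu : u ∈ K2 ends r s ω := by
    rw [mem_K2_iff]
    rcases ht with rfl | rfl
    · exact Or.inl (conn_symm hc)
    · exact Or.inr (conn_symm hc)
  rw [K2_restrict_eq, mem_K2_iff] at hu
  rcases hu with h | h
  · exact h1 (conn_symm h)
  · exact h2 (conn_symm h)

/-- **`Sep` does not see the edges inside `{r, s}`.** -/
lemma sep2_restrict_iff :
    sep2 ends p q r s ω ↔
      sep2 (fun e : {e // e ∉ within ends ({r, s} : Set V)} => ends e.1) p q r s
        (fun e => ω e.1) := by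
  constructor
  · rintro ⟨⟨h1, h2, h3, h4⟩, ⟨h5, h6, h7, h8⟩⟩
    exact ⟨⟨fun h => h1 (conn_of_conn_restrict h), fun h => h2 (conn_of_conn_restrict h),
      fun h => h3 (conn_of_conn_restrict h), fun h => h4 (conn_of_conn_restrict h)⟩,
      ⟨fun h => h5 (conn_of_conn_restrict (ω := OneColourSwitch.compl ω) h),
      fun h => h6 (conn_of_conn_restrict (ω := OneColourSwitch.compl ω) h),
      fun h => h7 (conn_of_conn_restrict (ω := OneColourSwitch.compl ω) h),
      fun h => h8 (conn_of_conn_restrict (ω := OneColourSwitch.compl ω) h)⟩⟩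
  · rintro ⟨⟨h1, h2, h3, h4⟩, ⟨h5, h6, h7, h8⟩⟩
    exact ⟨⟨not_conn_mark_restrict (Or.inl rfl) h1 h2, not_conn_mark_restrict (Or.inr rfl) h1 h2,
      not_conn_mark_restrict (Or.inl rfl) h3 h4, not_conn_mark_restrict (Or.inr rfl) h3 h4⟩,
      ⟨not_conn_mark_restrict (ω := OneColourSwitch.compl ω) (Or.inl rfl) h5 h6,
      not_conn_mark_restrict (ω := OneColourSwitch.compl ω) (Or.inr rfl) h5 h6,
      not_conn_mark_restrict (ω := OneColourSwitch.compl ω) (Or.inl rfl) h7 h8,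
      not_conn_mark_restrict (ω := OneColourSwitch.compl ω) (Or.inr rfl) h7 h8⟩⟩

/-- **`DOne` does not see the edges inside `{r, s}`.** -/
lemma DOne_restrict_iff :
    DOne ends r s d ω ↔
      DOne (fun e : {e // e ∉ within ends ({r, s} : Set V)} => ends e.1) r s d
        (fun e => ω e.1) := by
  unfold DOne
  rw [K2_restrict_eq r s ω, M2_restrict_eq r s ω]

/-- A `Y`-path from a vertex `x` not `Y`-joined to `r` or `s` is a restricted `Y`-path. -/
lemma conn_restrict_of_conn_of_not_mark {x y : V} (hr : ¬ Conn ends ω x r)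
    (hs : ¬ Conn ends ω x s) (h : Conn ends ω x y) :
    Conn (fun e : {e // e ∉ within ends ({r, s} : Set V)} => ends e.1) (fun e => ω e.1) x y := by
  refine conn_restrict_of_conn ?_ h
  intro e hP _ a b hab ha
  rw [not_not] at hP
  exfalso
  rcases (endpoint_of_mem_within hP hab).1 with rfl | rfl
  · exact hr (conn_of_conn_restrict ha)
  · exact hs (conn_of_conn_restrict ha)

/-- **`σ_pq` does not see the edges inside `{r, s}` at a `Sep` point.** -/
lemma sigma_pq_restrict_eq (hsep : sep2 ends p q r s ω) :
    sigma ends ω p q =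
      sigma (fun e : {e // e ∉ within ends ({r, s} : Set V)} => ends e.1) (fun e => ω e.1) p q := by
  obtain ⟨⟨h1, h2, _, _⟩, ⟨h5, h6, _, _⟩⟩ := hsep
  have hY : Conn ends ω p q ↔
      Conn (fun e : {e // e ∉ within ends ({r, s} : Set V)} => ends e.1) (fun e => ω e.1) p q :=
    ⟨conn_restrict_of_conn_of_not_mark h1 h2, conn_of_conn_restrict⟩
  have hW : Conn ends (OneColourSwitch.compl ω) p q ↔
      Conn (fun e : {e // e ∉ within ends ({r, s} : Set V)} => ends e.1)
        (fun e => OneColourSwitch.compl ω e.1) p q :=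
    ⟨conn_restrict_of_conn_of_not_mark h5 h6, conn_of_conn_restrict⟩
  unfold sigma
  rw [if_congr hY rfl rfl, if_congr hW rfl rfl]
  rfl

/-- **The `W`-cluster of `d ∉ M₂` does not see the edges inside `{r, s}`.** -/
lemma conn_compl_d_restrict_iff (hM : d ∉ M2 ends r s ω) {y : V} :
    Conn ends (OneColourSwitch.compl ω) d y ↔
      Conn (fun e : {e // e ∉ within ends ({r, s} : Set V)} => ends e.1)
        (fun e => OneColourSwitch.compl ω e.1) d y := by
  refine ⟨conn_restrict_of_conn_of_not_mark ?_ ?_, conn_of_conn_restrict⟩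
  · intro h; exact hM (mem_M2_iff.2 (Or.inl (conn_symm h)))
  · intro h; exact hM (mem_M2_iff.2 (Or.inr (conn_symm h)))

/-- **The `W`-defect does not see the edges inside `{r, s}` when `d ∉ M₂`.** -/
lemma WDefect_restrict_iff (hM : d ∉ M2 ends r s ω) :
    WDefect ends p q r s d ω ↔
      WDefect (fun e : {e // e ∉ within ends ({r, s} : Set V)} => ends e.1) p q r s d
        (fun e => ω e.1) := by
  unfold WDefect
  rw [conn_compl_d_restrict_iff hM, conn_compl_d_restrict_iff hM, K2_restrict_eq r s ω]
  constructor
  · rintro (h | h | ⟨x, hxr, hxs, hxd, hxK, hx⟩)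
    · exact Or.inl h
    · exact Or.inr (Or.inl h)
    · exact Or.inr (Or.inr ⟨x, hxr, hxs, hxd, hxK, (conn_compl_d_restrict_iff hM).1 hx⟩)
  · rintro (h | h | ⟨x, hxr, hxs, hxd, hxK, hx⟩)
    · exact Or.inl h
    · exact Or.inr (Or.inl h)
    · exact Or.inr (Or.inr ⟨x, hxr, hxs, hxd, hxK, (conn_compl_d_restrict_iff hM).2 hx⟩)

/-- **`r ~_Y s` holds iff it holds in the restriction or an open `r`–`s` edge was removed.** -/
lemma conn_rs_restrict_iff :
    Conn ends ω r s ↔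
      Conn (fun e : {e // e ∉ within ends ({r, s} : Set V)} => ends e.1) (fun e => ω e.1) r s ∨
        ∃ e, e ∈ within ends ({r, s} : Set V) ∧ ω e = true ∧ ends e = s(r, s) := by
  constructor
  · intro h
    by_cases hex : ∃ e, e ∈ within ends ({r, s} : Set V) ∧ ω e = true ∧ ends e = s(r, s)
    · exact Or.inr hex
    · left
      refine conn_restrict_of_conn ?_ h
      intro e hP he a b hab ha
      rw [not_not] at hP
      obtain ⟨ha', hb'⟩ := endpoint_of_mem_within hP hab
      rcases ha' with rfl | rfl <;> rcases hb' with rfl | rfl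
      · exact ha
      · exact (hex ⟨e, hP, he, hab⟩).elim
      · exact (hex ⟨e, hP, he, by rw [hab, Sym2.eq_swap]⟩).elim
      · exact ha
  · rintro (h | ⟨e, _, he, hends⟩)
    · exact conn_of_conn_restrict h
    · exact conn_of_openAdj ⟨e, he, hends⟩

end Marks

end NoPocket

end Summit.Ventures.PercRepro2
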